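import Mathlib.LinearAlgebra.Matrix.PosDef
import Mathlib.Analysis.InnerProductSpace.Calculus
import Literature.Analysis.FunctionSpaces.TorusCalculusProofs
import Literature.Analysis.FunctionSpaces.TorusSpaceTime
import Literature.Analysis.FunctionSpaces.TorusEnstrophyOrthogonality
import Literature.MathematicalPhysics.KineticTheory.HardSphereEulerLocalTheoryProofs
import HarnessLib

/-!
# The symmetric `5 × 5` form of the hard-sphere compressible Euler system on `𝕋³`, and the
reduction of `hsEuler_localExistence` to the local existence theorem for smooth symmetric
hyperbolic systems

MathematicalPhysics/KineticTheory, companion of `HardSphereEulerLocalTheory.lean` (the named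
fact `hsEuler_localExistence`, Dafermos 2005, Ch. V §5.1, Thm 5.1.1, existence clause), of
`HardSphereEulerLocalTheoryProofs.lean` (Steps 0 and 5a–5c of the printed proof: the equation of
state at small packing; primitive ⇒ conservation form; symmetrised rows ⇒ primitive form) and of
`HardSphereEulerLocalTheoryReduction.lean`, which ALREADY reduces `hsEuler_localExistence` (and
`hsEuler_continuation`) to the one named fact under which Majda's theorem is vendored in the tree,
`Literature.Analysis.FluidPDE.CompressibleEulerLocalWellPosedness`
(`Literature/Analysis/FluidPDE/CompressibleEulerWellPosedness.lean`: Majda 1984, Ch. 2,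
Thms 2.1–2.2 with Cor. 1–2, for the `5 × 5` Euler system of a monatomic fluid with an arbitrary
smooth athermal pressure law `p = ρθζ(ρ)` on `𝕋³`), via
`hsEuler_localExistence_of_compressibleEulerLocalWellPosedness`. **The literature debt behind
`hsEuler_localExistence` is therefore exactly `CompressibleEulerLocalWellPosedness_holds`; this
file adds no alternative debt and nothing in it is to be vendored as a further named fact.** What
it supplies is the concrete symmetric (Friedrichs) form of the system — the structure any proof of
that fact by the energy method starts from — and the assembly of `hsEuler_localExistence` from
the GENERAL symmetric-hyperbolic local existence theorem, kept as an explicit hypothesis: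

* Step 5d — **the concrete symmetric form.** In the variables `V = (ρ, u₁, u₂, u₃, θ) ∈ ℝ⁵`
  (`hsVelIdx`, `hsVelPart`, `hsStateVec`) the hard-sphere Euler system for classical solutions reads
  `A⁰(V)∂ₜV + ∑ₖ Aₖ(V)∂ₖV = 0` with the Friedrichs symmetriser
  `A⁰(V) = diag(p_ρ/ρ, ρ, ρ, ρ, 3ρ/(2θ))` (`hsSymA0`) and the symmetric matrices
  `Aₖ(V) = uₖA⁰(V) + p_ρ(E_{0,k+1} + E_{k+1,0}) + p_θ(E_{k+1,4} + E_{4,k+1})` (`hsSymA`), where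
  `p_ρ = θ(1 + 2ηF' + η²F'')(ρσ³)` (`hsDpDrho`) and `p_θ = ρ(1 + ηF')(ρσ³)` (`hsDpDtheta`) are
  the partial derivatives of the pressure law on the state domain
  (`deriv_hsPressure_density_eq_hsDpDrho`, `deriv_hsPressure_temperature_eq_hsDpDtheta`). On the
  state domain `𝒪_{σ,η} = {ρ > 0, θ > 0, ρσ³ < η}` (`hsStateDomain`, open) the coefficients are
  smooth entrywise (`contDiffOn_hsSymA0_hsSymA`), `A⁰` is symmetric positive definite as soon as
  `p_ρ > 0` (`posDef_hsSymA0`; guaranteed for `η = η_c(η₀, F)`, the packing threshold of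
  `exists_packing_threshold`), the `Aₖ` are symmetric (`isSymm_hsSymA`), and the rows of
  `A⁰w₀ + ∑ₖAₖwₖ` are computed in `hsSym_row_zero/_vel/_four`. A jointly smooth solution `V` of
  the symmetric system with values in `𝒪_{σ,η_c}` is a classical hard-sphere Euler solution
  (`IsHardSphereEulerSolution.of_symmVector`, through `.of_symmetricForm` and `.of_primitive`).
* Step 5e — **the reduction** `hsEuler_localExistence_of_symmHyperbolicLocalExistence`:
  `hsEuler_localExistence` follows from the local existence theorem for smooth symmetric
  hyperbolic quasilinear systems on `𝕋³` in its `C^∞` form, taken as an explicit HYPOTHESIS `H`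
  (spelled out in the theorem; nothing is asserted): for every `N`, open `𝒪 ⊆ ℝᴺ`, coefficients
  `A⁰, A₁, A₂, A₃ : ℝᴺ → ℝ^{N×N}` smooth on `𝒪` with `A⁰` symmetric positive definite and `Aₖ`
  symmetric there, and smooth data `V₀ : 𝕋³ → ℝᴺ` with values in a compact subset of `𝒪`, there
  are `T > 0` and a jointly smooth `V` on `[0, T) × 𝕋³` with values in `𝒪`, `V(0) = V₀`,
  solving `A⁰(V)∂ₜV + ∑ₖAₖ(V)∂ₖV = 0`. This is Majda 1984, Ch. 2, §2.1, Thm 2.1 (local `Hˢ`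
  solution, `s > 3/2 + 1`, with values in `G₂ ⊂⊂ G` for data with values in `G₁ ⊂⊂ G`) together
  with Thm 2.2 and its Cor. 1–2 (the life span does not depend on `s`, so `H^∞ = C^∞(𝕋³)` data
  give solutions `C^∞` on `[0, T) × 𝕋³`); equivalently Kato 1975, Thms I–II (uniformly local
  Sobolev data, which include periodic data), Taylor, *PDE III*, Ch. 16, §§1–2 (compact
  manifolds, in particular `𝕋ⁿ`), and Steps 1–4 of the proof of Dafermos' Thm 5.1.1 — i.e. the
  `TODO(general form)` recorded under both `hsEuler_localExistence` and
  `CompressibleEulerLocalWellPosedness`. **`H` must NOT be vendored as a separate named fact**: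
  Majda's theorem is vendored once, as `CompressibleEulerLocalWellPosedness`, and the
  non-duplicating ways to discharge `hsEuler_localExistence` are (a) to prove
  `CompressibleEulerLocalWellPosedness_holds` and apply
  `hsEuler_localExistence_of_compressibleEulerLocalWellPosedness`
  (`HardSphereEulerLocalTheoryReduction.lean`), or (b) to PROVE the general theorem `H` as a
  theorem of the tree (or to generalise that single fact to it), after which both
  `hsEuler_localExistence` (by the theorem below) and clause (i) of
  `CompressibleEulerLocalWellPosedness` (by the same assembly for a general `ζ`) follow.

Everything below is proved; no named fact and no `sorry` is introduced. The definitions are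
concrete (`5 × 5` real matrices, index maps, the state domain) and carry no mathematical claim.

## Mathlib / tree search

Mathlib: `Matrix.posDef_diagonal_iff`, `Matrix.IsSymm.ext`, `contDiff_euclidean`,
`LinearMap.toContinuousLinearMap`, `ContDiffOn.div`, `AnalyticOnNhd.contDiffOn_of_completeSpace`.
Tree: `IsHardSphereEulerSolution.of_symmetricForm`, `exists_packing_threshold`,
`deriv_hsPressure_density_ge`, `hasDerivAt_hsPressure_density/_temperature`,
`hsCompressibility_eq` (`HardSphereEulerLocalTheoryProofs`); `IsSmoothSpaceTimeOn.clm_comp`,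
`.hasDerivWithinAt_slice`, `.isSmooth_slice` (`TorusSpaceTime`, `TorusCalculusProofs`);
`Torus.partialDeriv_eq_fderiv_apply`, `Torus.partialDeriv_apply_coord`. Majda's theorem in the
tree: the named fact `Literature.Analysis.FluidPDE.CompressibleEulerLocalWellPosedness`
(unproved; `5 × 5` athermal Euler on `𝕋³`) and the reduction
`hsEuler_localExistence_of_compressibleEulerLocalWellPosedness`
(`HardSphereEulerLocalTheoryReduction.lean`); PROVED hyperbolic theory in the tree: the linear
whole-space energy method `Literature.Analysis.PDE.SymmetricHyperbolicExistence`
(`exists_smooth_solution`), the small-data whole-space Kato programme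
`Literature/Barriers/AtomisticToContinuum/NoBVEstimatesMultiD*`, and the Fourier–Galerkin `Hᵐ`
method for incompressible flows on `𝕋³` (`FluidPDE/GalerkinSmooth*`); no proof of the general
theorem `H` (quasilinear, symmetric, `𝕋³`) exists yet.

## References

* C. M. Dafermos, *Hyperbolic Conservation Laws in Continuum Physics*, 2nd ed., Grundlehren 325,
  Springer 2005: §1.5 (symmetrisable systems); Ch. V, §5.1, Thm 5.1.1 and its proof; §5.4.
  [`Dafermos2005`]
* A. Majda, *Compressible Fluid Flow and Systems of Conservation Laws in Several Space
  Variables*, Appl. Math. Sci. 53, Springer 1984: §1.2 (symmetrisation of the equations of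
  compressible fluid flow), Ch. 2, §2.1, Thm 2.1, Thm 2.2, Cor. 1–2. [`Majda1984`]
* T. Kato, Arch. Rational Mech. Anal. 58 (1975) 181–205, Thms I–II. [`Kato1975`]
* M. E. Taylor, *Partial Differential Equations III*, 2nd ed., Springer 2011: Ch. 16, §§1–2,
  §5. [`TaylorPDEIII2011`]
-/

noncomputable section

open Set Filter Topology
open scoped ContDiff

namespace Literature.MathematicalPhysics.KineticTheory

open Literature.Analysis.FunctionSpaces Literature.Analysis.FunctionSpaces.Torus


/-! ### Step 5d: the symmetric `5 × 5` form of the hard-sphere Euler system -/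

section SymmetricForm

variable {η₀ : ℝ} {F : ℝ → ℝ}

/-- Local notation: the state space `ℝ⁵ ∋ V = (ρ, u₁, u₂, u₃, θ)`. -/
local notation "E5" => EuclideanSpace ℝ (Fin 5)

/-- The index in `Fin 5` of the `k`-th velocity component (`k + 1`). [folklore] -/
def hsVelIdx : Fin 3 → Fin 5 := ![1, 2, 3]

/-- `hsVelIdx 0 = 1`. [folklore] -/
@[simp] theorem hsVelIdx_zero : hsVelIdx 0 = 1 := rfl

/-- `hsVelIdx 1 = 2`. [folklore] -/
@[simp] theorem hsVelIdx_one : hsVelIdx 1 = 2 := rfl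

/-- `hsVelIdx 2 = 3`. [folklore] -/
@[simp] theorem hsVelIdx_two : hsVelIdx 2 = 3 := rfl

/-- The analytic formula for `∂p/∂ρ (ρ, θ) = θ (1 + 2ηF'(η) + η²F''(η))`, `η = ρσ³` (equal to the
true derivative on the state domain, `hasDerivAt_hsPressure_density`). [cite: Dafermos2005, Thm 5.1.1] -/
def hsDpDrho (F : ℝ → ℝ) (σ ρ θ : ℝ) : ℝ :=
  θ * (1 + 2 * (ρ * σ ^ 3) * deriv F (ρ * σ ^ 3) + (ρ * σ ^ 3) ^ 2 * deriv (deriv F) (ρ * σ ^ 3))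

/-- The analytic formula for `∂p/∂θ (ρ, θ) = ρ Z(ρσ³) = ρ (1 + ηF'(η))`, `η = ρσ³`.
[cite: Dafermos2005, Thm 5.1.1] -/
def hsDpDtheta (F : ℝ → ℝ) (σ ρ : ℝ) : ℝ :=
  ρ * (1 + ρ * σ ^ 3 * deriv F (ρ * σ ^ 3))

/-- The constant matrix `E₀₀`. [folklore] -/
def hsSymD0 : Matrix (Fin 5) (Fin 5) ℝ :=
  !![1, 0, 0, 0, 0; 0, 0, 0, 0, 0; 0, 0, 0, 0, 0; 0, 0, 0, 0, 0; 0, 0, 0, 0, 0]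

/-- The constant matrix `E₁₁ + E₂₂ + E₃₃`. [folklore] -/
def hsSymD1 : Matrix (Fin 5) (Fin 5) ℝ :=
  !![0, 0, 0, 0, 0; 0, 1, 0, 0, 0; 0, 0, 1, 0, 0; 0, 0, 0, 1, 0; 0, 0, 0, 0, 0]

/-- The constant matrix `E₄₄`. [folklore] -/
def hsSymD4 : Matrix (Fin 5) (Fin 5) ℝ :=
  !![0, 0, 0, 0, 0; 0, 0, 0, 0, 0; 0, 0, 0, 0, 0; 0, 0, 0, 0, 0; 0, 0, 0, 0, 1]

/-- The constant symmetric matrices `E_{0,k+1} + E_{k+1,0}`, `k = 0, 1, 2`. [folklore] -/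
def hsSymP : Fin 3 → Matrix (Fin 5) (Fin 5) ℝ :=
  ![!![0, 1, 0, 0, 0; 1, 0, 0, 0, 0; 0, 0, 0, 0, 0; 0, 0, 0, 0, 0; 0, 0, 0, 0, 0],
    !![0, 0, 1, 0, 0; 0, 0, 0, 0, 0; 1, 0, 0, 0, 0; 0, 0, 0, 0, 0; 0, 0, 0, 0, 0],
    !![0, 0, 0, 1, 0; 0, 0, 0, 0, 0; 0, 0, 0, 0, 0; 1, 0, 0, 0, 0; 0, 0, 0, 0, 0]]

/-- The constant symmetric matrices `E_{k+1,4} + E_{4,k+1}`, `k = 0, 1, 2`. [folklore] -/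
def hsSymQ : Fin 3 → Matrix (Fin 5) (Fin 5) ℝ :=
  ![!![0, 0, 0, 0, 0; 0, 0, 0, 0, 1; 0, 0, 0, 0, 0; 0, 0, 0, 0, 0; 0, 1, 0, 0, 0],
    !![0, 0, 0, 0, 0; 0, 0, 0, 0, 0; 0, 0, 0, 0, 1; 0, 0, 0, 0, 0; 0, 0, 1, 0, 0],
    !![0, 0, 0, 0, 0; 0, 0, 0, 0, 0; 0, 0, 0, 0, 0; 0, 0, 0, 0, 1; 0, 0, 0, 1, 0]]

/-- The Friedrichs symmetriser `A⁰(V) = diag(p_ρ/ρ, ρ, ρ, ρ, 3ρ/(2θ))` of the hard-sphere Euler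
system in the variables `V = (ρ, u, θ)`. Friedrichs symmetriser of the athermal hard-sphere gas, obtained by
weighting the primitive equations with `(p_ρ/ρ, 1, 1, 1, 1/θ)`; cf. Dafermos 2005, §1.5, Majda 1984,
§1.2. [folklore] -/
def hsSymA0 (F : ℝ → ℝ) (σ : ℝ) (v : E5) : Matrix (Fin 5) (Fin 5) ℝ :=
  (hsDpDrho F σ (v 0) (v 4) / v 0) • hsSymD0 + v 0 • hsSymD1 + (3 * v 0 / (2 * v 4)) • hsSymD4

/-- The symmetric coefficient matrices
`Aₖ(V) = uₖ A⁰(V) + p_ρ (E_{0,k+1} + E_{k+1,0}) + p_θ (E_{k+1,4} + E_{4,k+1})`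
(cf. Dafermos 2005, §1.5; Majda 1984, §1.2). [folklore] -/
def hsSymA (F : ℝ → ℝ) (σ : ℝ) (k : Fin 3) (v : E5) : Matrix (Fin 5) (Fin 5) ℝ :=
  v (hsVelIdx k) • hsSymA0 F σ v + hsDpDrho F σ (v 0) (v 4) • hsSymP k + hsDpDtheta F σ (v 0) • hsSymQ k

/-- The state domain `𝒪_{σ,η} = {ρ > 0, θ > 0, ρσ³ < η}` in the variables `V = (ρ, u, θ)`.
[cite: Dafermos2005, Thm 5.1.1] -/
def hsStateDomain (σ η : ℝ) : Set E5 := {v | 0 < v 0 ∧ 0 < v 4 ∧ v 0 * σ ^ 3 < η}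

/-- The state domain is open. [folklore] -/
theorem isOpen_hsStateDomain (σ η : ℝ) : IsOpen (hsStateDomain σ η) := by
  have h0 : Continuous fun v : E5 => v 0 := (EuclideanSpace.proj (0 : Fin 5)).continuous
  have h4 : Continuous fun v : E5 => v 4 := (EuclideanSpace.proj (4 : Fin 5)).continuous
  have h : hsStateDomain σ η =
      ({v : E5 | 0 < v 0} ∩ {v : E5 | 0 < v 4}) ∩ {v : E5 | v 0 * σ ^ 3 < η} := by
    ext v
    simp [hsStateDomain, and_assoc]
  rw [h]
  exact ((isOpen_lt continuous_const h0).inter (isOpen_lt continuous_const h4)).inter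
    (isOpen_lt (h0.mul continuous_const) continuous_const)

/-- `A⁰(V)` is the diagonal matrix `diag(p_ρ/ρ, ρ, ρ, ρ, 3ρ/(2θ))`. [folklore] -/
theorem hsSymA0_eq_diagonal (F : ℝ → ℝ) (σ : ℝ) (v : E5) :
    hsSymA0 F σ v =
      Matrix.diagonal ![hsDpDrho F σ (v 0) (v 4) / v 0, v 0, v 0, v 0, 3 * v 0 / (2 * v 4)] := by
  ext i j
  fin_cases i <;> fin_cases j <;> simp [hsSymA0, hsSymD0, hsSymD1, hsSymD4, Matrix.diagonal]

/-- Row `0` (density) of `A⁰(V)w₀ + ∑ₖ Aₖ(V)wₖ`. [folklore] -/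
theorem hsSym_row_zero (F : ℝ → ℝ) (σ : ℝ) (v : E5) (w₀ : Fin 5 → ℝ) (w : Fin 3 → Fin 5 → ℝ) :
    ((hsSymA0 F σ v).mulVec w₀ + ∑ k, (hsSymA F σ k v).mulVec (w k)) 0 =
      hsDpDrho F σ (v 0) (v 4) / v 0 * (w₀ 0 + ∑ k, v (hsVelIdx k) * w k 0) +
        hsDpDrho F σ (v 0) (v 4) * ∑ k, w k (hsVelIdx k) := by
  simp [hsSymA, hsSymA0, hsSymD0, hsSymD1, hsSymD4, hsSymP, hsSymQ, dotProduct, Fin.sum_univ_five,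
    Fin.sum_univ_three]
  ring

/-- Rows `1, 2, 3` (velocity) of `A⁰(V)w₀ + ∑ₖ Aₖ(V)wₖ`. [folklore] -/
theorem hsSym_row_vel (F : ℝ → ℝ) (σ : ℝ) (v : E5) (w₀ : Fin 5 → ℝ) (w : Fin 3 → Fin 5 → ℝ)
    (j : Fin 3) :
    ((hsSymA0 F σ v).mulVec w₀ + ∑ k, (hsSymA F σ k v).mulVec (w k)) (hsVelIdx j) =
      v 0 * (w₀ (hsVelIdx j) + ∑ k, v (hsVelIdx k) * w k (hsVelIdx j)) +
        hsDpDrho F σ (v 0) (v 4) * w j 0 + hsDpDtheta F σ (v 0) * w j 4 := by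
  fin_cases j <;>
  · simp [hsSymA, hsSymA0, hsSymD0, hsSymD1, hsSymD4, hsSymP, hsSymQ, dotProduct, Fin.sum_univ_five,
      Fin.sum_univ_three]
    ring

/-- Row `4` (temperature) of `A⁰(V)w₀ + ∑ₖ Aₖ(V)wₖ`. [folklore] -/
theorem hsSym_row_four (F : ℝ → ℝ) (σ : ℝ) (v : E5) (w₀ : Fin 5 → ℝ) (w : Fin 3 → Fin 5 → ℝ) :
    ((hsSymA0 F σ v).mulVec w₀ + ∑ k, (hsSymA F σ k v).mulVec (w k)) 4 =
      3 * v 0 / (2 * v 4) * (w₀ 4 + ∑ k, v (hsVelIdx k) * w k 4) +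
        hsDpDtheta F σ (v 0) * ∑ k, w k (hsVelIdx k) := by
  simp [hsSymA, hsSymA0, hsSymD0, hsSymD1, hsSymD4, hsSymP, hsSymQ, dotProduct, Fin.sum_univ_five,
    Fin.sum_univ_three]
  ring
set_option maxHeartbeats 400000 in
/-- The matrices `Aₖ(V)` are symmetric. [folklore] -/
theorem isSymm_hsSymA (F : ℝ → ℝ) (σ : ℝ) (k : Fin 3) (v : E5) : (hsSymA F σ k v).IsSymm := by
  refine Matrix.IsSymm.ext fun i j => ?_
  fin_cases k <;> fin_cases i <;> fin_cases j <;>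
    simp [hsSymA, hsSymA0, hsSymD0, hsSymD1, hsSymD4, hsSymP, hsSymQ, Matrix.add_apply]


/-! #### Smoothness, positivity and the identification with the pressure derivatives -/

/-- On packing fractions in `(0, η₀)`, `hsDpDrho` IS `∂p/∂ρ`. [folklore] -/
theorem deriv_hsPressure_density_eq_hsDpDrho (hFa : AnalyticOnNhd ℝ F (Ioo (-η₀) η₀))
    (hF : EqOn hsExcessFreeEnergy F (Ico 0 η₀)) {σ ρ : ℝ} (θ : ℝ) (hρ : ρ * σ ^ 3 ∈ Ioo 0 η₀) :
    deriv (fun r => hsPressure σ r θ) ρ = hsDpDrho F σ ρ θ :=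
  (hasDerivAt_hsPressure_density hFa hF θ hρ).deriv

/-- On packing fractions in `(0, η₀)`, `hsDpDtheta` IS `∂p/∂θ`. [folklore] -/
theorem deriv_hsPressure_temperature_eq_hsDpDtheta (hF : EqOn hsExcessFreeEnergy F (Ico 0 η₀))
    {σ ρ : ℝ} (θ : ℝ) (hρ : ρ * σ ^ 3 ∈ Ioo 0 η₀) :
    deriv (fun s => hsPressure σ ρ s) θ = hsDpDtheta F σ ρ := by
  rw [(hasDerivAt_hsPressure_temperature σ ρ θ).deriv, hsCompressibility_eq hF hρ, hsDpDtheta]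

/-- The coordinate `v ↦ v i` is smooth on any set. [folklore] -/
theorem hsState_contDiffOn_coord (i : Fin 5) (O : Set E5) : ContDiffOn ℝ ∞ (fun v : E5 => v i) O :=
  (EuclideanSpace.proj i : E5 →L[ℝ] ℝ).contDiff.contDiffOn

/-- `v ↦ F'(v₀σ³)` and `v ↦ F''(v₀σ³)` are smooth on the state domain `𝒪_{σ,η}`, `η ≤ η₀`,
`σ ≥ 0`. [folklore] -/
theorem contDiffOn_derivF_comp (hFa : AnalyticOnNhd ℝ F (Ioo (-η₀) η₀)) {σ η : ℝ} (hσ : 0 ≤ σ)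
    (hη : η ≤ η₀) :
    ContDiffOn ℝ ∞ (fun v : E5 => deriv F (v 0 * σ ^ 3)) (hsStateDomain σ η) ∧
      ContDiffOn ℝ ∞ (fun v : E5 => deriv (deriv F) (v 0 * σ ^ 3)) (hsStateDomain σ η) := by
  have hmaps : MapsTo (fun v : E5 => v 0 * σ ^ 3) (hsStateDomain σ η) (Ioo (-η₀) η₀) := by
    intro v hv
    have h1 : 0 ≤ v 0 * σ ^ 3 := mul_nonneg hv.1.le (pow_nonneg hσ 3)
    exact ⟨by linarith [hv.2.2], lt_of_lt_of_le hv.2.2 hη⟩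
  have hlin : ContDiffOn ℝ ∞ (fun v : E5 => v 0 * σ ^ 3) (hsStateDomain σ η) :=
    (hsState_contDiffOn_coord 0 _).mul contDiffOn_const
  exact ⟨(hFa.deriv.contDiffOn_of_completeSpace).comp hlin hmaps,
    (hFa.deriv.deriv.contDiffOn_of_completeSpace).comp hlin hmaps⟩

/-- `v ↦ p_ρ(v)` and `v ↦ p_θ(v)` are smooth on the state domain. [folklore] -/
theorem contDiffOn_hsDpDrho_hsDpDtheta (hFa : AnalyticOnNhd ℝ F (Ioo (-η₀) η₀)) {σ η : ℝ}
    (hσ : 0 ≤ σ) (hη : η ≤ η₀) :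
    ContDiffOn ℝ ∞ (fun v : E5 => hsDpDrho F σ (v 0) (v 4)) (hsStateDomain σ η) ∧
      ContDiffOn ℝ ∞ (fun v : E5 => hsDpDtheta F σ (v 0)) (hsStateDomain σ η) := by
  obtain ⟨h1, h2⟩ := contDiffOn_derivF_comp hFa hσ hη
  have hlin : ContDiffOn ℝ ∞ (fun v : E5 => v 0 * σ ^ 3) (hsStateDomain σ η) :=
    (hsState_contDiffOn_coord 0 _).mul contDiffOn_const
  refine ⟨?_, ?_⟩
  · unfold hsDpDrho
    exact (hsState_contDiffOn_coord 4 _).mul ((contDiffOn_const.add ((contDiffOn_const.mul hlin).mul h1)).add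
      ((hlin.pow 2).mul h2))
  · unfold hsDpDtheta
    exact (hsState_contDiffOn_coord 0 _).mul (contDiffOn_const.add (hlin.mul h1))

/-- **The coefficients `A⁰(V)`, `Aₖ(V)` are smooth on the state domain**, entry by entry.
[folklore] -/
theorem contDiffOn_hsSymA0_hsSymA (hFa : AnalyticOnNhd ℝ F (Ioo (-η₀) η₀)) {σ η : ℝ} (hσ : 0 ≤ σ)
    (hη : η ≤ η₀) :
    (∀ i j, ContDiffOn ℝ ∞ (fun v : E5 => hsSymA0 F σ v i j) (hsStateDomain σ η)) ∧
      ∀ k i j, ContDiffOn ℝ ∞ (fun v : E5 => hsSymA F σ k v i j) (hsStateDomain σ η) := by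
  obtain ⟨hpρ, hpθ⟩ := contDiffOn_hsDpDrho_hsDpDtheta hFa hσ hη
  have h0 : ∀ v ∈ hsStateDomain σ η, (fun v : E5 => v 0) v ≠ 0 := fun v hv => hv.1.ne'
  have h4 : ∀ v ∈ hsStateDomain σ η, (fun v : E5 => 2 * v 4) v ≠ 0 := fun v hv => by
    have := hv.2.1; positivity
  have hd0 : ContDiffOn ℝ ∞ (fun v : E5 => hsDpDrho F σ (v 0) (v 4) / v 0) (hsStateDomain σ η) :=
    hpρ.div (hsState_contDiffOn_coord 0 _) h0
  have hd4 : ContDiffOn ℝ ∞ (fun v : E5 => 3 * v 0 / (2 * v 4)) (hsStateDomain σ η) :=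
    (contDiffOn_const.mul (hsState_contDiffOn_coord 0 _)).div (contDiffOn_const.mul (hsState_contDiffOn_coord 4 _)) h4
  have hA0 : ∀ i j, ContDiffOn ℝ ∞ (fun v : E5 => hsSymA0 F σ v i j) (hsStateDomain σ η) := by
    intro i j
    simp only [hsSymA0, Matrix.add_apply, Matrix.smul_apply, smul_eq_mul]
    exact ((hd0.mul contDiffOn_const).add ((hsState_contDiffOn_coord 0 _).mul contDiffOn_const)).add
      (hd4.mul contDiffOn_const)
  refine ⟨hA0, fun k i j => ?_⟩
  simp only [hsSymA, Matrix.add_apply, Matrix.smul_apply, smul_eq_mul]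
  exact (((hsState_contDiffOn_coord _ _).mul (hA0 i j)).add (hpρ.mul contDiffOn_const)).add
    (hpθ.mul contDiffOn_const)

/-- **`A⁰(V)` is symmetric positive definite** wherever `ρ, θ > 0` and `p_ρ > 0`. [folklore] -/
theorem posDef_hsSymA0 (F : ℝ → ℝ) (σ : ℝ) {v : E5} (h0 : 0 < v 0) (h4 : 0 < v 4)
    (hp : 0 < hsDpDrho F σ (v 0) (v 4)) : (hsSymA0 F σ v).PosDef := by
  rw [hsSymA0_eq_diagonal, Matrix.posDef_diagonal_iff]
  intro i
  fin_cases i <;> simp <;> positivity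

/-! #### Coordinates and continuous linear maps commute with the torus derivatives -/

/-- One-sided time derivatives commute with continuous linear maps. [folklore] -/
theorem timeDerivWithin_clm_apply {F' G' : Type*} [NormedAddCommGroup F'] [NormedSpace ℝ F']
    [NormedAddCommGroup G'] [NormedSpace ℝ G'] (L : F' →L[ℝ] G') {S : Set ℝ}
    {V : ℝ → T3 → F'} (hV : IsSmoothSpaceTimeOn S V) (hS : UniqueDiffOn ℝ S) {t : ℝ} (ht : t ∈ S)
    (x : T3) : timeDerivWithin S (fun s y => L (V s y)) t x = L (timeDerivWithin S V t x) :=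
  (L.hasFDerivAt.comp_hasDerivWithinAt t (hV.hasDerivWithinAt_slice ht x)).derivWithin (hS t ht)

/-- Partial derivatives commute with continuous linear maps (`C¹` functions). [folklore] -/
theorem partialDeriv_clm_apply_of_isContDiff {F' G' : Type*} [NormedAddCommGroup F']
    [NormedSpace ℝ F'] [NormedAddCommGroup G'] [NormedSpace ℝ G'] (L : F' →L[ℝ] G')
    {f : T3 → F'} (hf : IsContDiff 1 f) (i : Fin 3) (x : T3) :
    partialDeriv i (fun y => L (f y)) x = L (partialDeriv i f x) := by
  have hLf : IsContDiff 1 (fun y => L (f y)) := L.contDiff.comp hf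
  rw [partialDeriv_eq_fderiv_apply hLf, partialDeriv_eq_fderiv_apply hf]
  have hd : DifferentiableAt ℝ (liftAt f x) 0 :=
    ((hf.liftAt x).differentiable one_ne_zero).differentiableAt
  have h : Torus.fderiv (fun y => L (f y)) x = L.comp (Torus.fderiv f x) := by
    have hl : liftAt (fun y => L (f y)) x = L ∘ liftAt f x := by funext v; rfl
    rw [Torus.fderiv, Torus.fderiv, hl]
    exact (L.hasFDerivAt.comp (0 : EuclideanSpace ℝ (Fin 3)) hd.hasFDerivAt).fderiv
  rw [h]
  rfl


/-! #### From a solution of the symmetric vector system to a hard-sphere Euler solution -/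

/-- The velocity part `u = (V₁, V₂, V₃)` of a state vector `V = (ρ, u, θ) ∈ ℝ⁵`, as a continuous
linear map `ℝ⁵ → ℝ³`. [folklore] -/
def hsVelPart : E5 →L[ℝ] V3 :=
  LinearMap.toContinuousLinearMap
    { toFun := fun v => WithLp.toLp 2 fun k => v (hsVelIdx k)
      map_add' := fun v w => by ext k; simp
      map_smul' := fun c v => by ext k; simp }

/-- `(hsVelPart V)ₖ = V_{k+1}`. [folklore] -/
@[simp] theorem hsVelPart_apply (v : E5) (k : Fin 3) : hsVelPart v k = v (hsVelIdx k) := rfl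

/-- **A smooth solution of the symmetric `5 × 5` system with values in the state domain
`𝒪_{σ,η_c}` is a classical hard-sphere Euler solution** (in the variables `ρ = V₀`,
`u = (V₁, V₂, V₃)`, `θ = V₄`), provided `η_c < η₀` is a packing threshold of
`exists_packing_threshold` (so that `p_ρ > 0` on the state domain) and `σ > 0`.
[cite: Dafermos2005, Thm 5.1.1] -/
theorem IsHardSphereEulerSolution.of_symmVector (hFa : AnalyticOnNhd ℝ F (Ioo (-η₀) η₀))
    (hF : EqOn hsExcessFreeEnergy F (Ico 0 η₀)) {η_c : ℝ} (hcη₀ : η_c < η₀)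
    (hc : ∀ η ∈ Icc (-η_c) η_c, 1 / 2 ≤ 1 + 2 * η * deriv F η + η ^ 2 * deriv (deriv F) η)
    {σ T : ℝ} (hσ : 0 < σ) {V : ℝ → T3 → E5} (hV : IsSmoothSpaceTimeOn (Ico 0 T) V)
    (hVO : ∀ t ∈ Ico 0 T, ∀ x, V t x ∈ hsStateDomain σ η_c)
    (hEq : ∀ t ∈ Ico 0 T, ∀ x,
      (hsSymA0 F σ (V t x)).mulVec (WithLp.ofLp (timeDerivWithin (Ico 0 T) V t x)) +
        ∑ k, (hsSymA F σ k (V t x)).mulVec (WithLp.ofLp (partialDeriv k (V t) x)) = 0) :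
    IsHardSphereEulerSolution σ T (fun t x => V t x 0) (fun t x => hsVelPart (V t x))
      (fun t x => V t x 4) := by
  have hS : UniqueDiffOn ℝ (Ico 0 T) := uniqueDiffOn_Ico 0 T
  -- smoothness of the components
  have hρ : IsSmoothSpaceTimeOn (Ico 0 T) (fun t x => V t x 0) :=
    hV.clm_comp (EuclideanSpace.proj (0 : Fin 5))
  have hθ : IsSmoothSpaceTimeOn (Ico 0 T) (fun t x => V t x 4) :=
    hV.clm_comp (EuclideanSpace.proj (4 : Fin 5))
  have hu : IsSmoothSpaceTimeOn (Ico 0 T) (fun t x => hsVelPart (V t x)) := hV.clm_comp hsVelPart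
  have hV1 : ∀ {t}, t ∈ Ico 0 T → IsContDiff 1 (V t) := fun ht =>
    (hV.isSmooth_slice ht).isContDiff (by simp)
  -- positivity, packing and `p_ρ > 0`
  have hρpos : ∀ t ∈ Ico 0 T, ∀ x, 0 < V t x 0 := fun t ht x => (hVO t ht x).1
  have hθpos : ∀ t ∈ Ico 0 T, ∀ x, 0 < V t x 4 := fun t ht x => (hVO t ht x).2.1
  have hpack : ∀ t ∈ Ico 0 T, ∀ x, V t x 0 * σ ^ 3 ∈ Ioo 0 η₀ := fun t ht x =>
    ⟨mul_pos (hρpos t ht x) (pow_pos hσ 3), (hVO t ht x).2.2.trans hcη₀⟩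
  have hdρ : ∀ t ∈ Ico 0 T, ∀ x, deriv (fun r => hsPressure σ r (V t x 4)) (V t x 0) =
      hsDpDrho F σ (V t x 0) (V t x 4) := fun t ht x =>
    deriv_hsPressure_density_eq_hsDpDrho hFa hF _ (hpack t ht x)
  have hdθ : ∀ t ∈ Ico 0 T, ∀ x, deriv (fun s => hsPressure σ (V t x 0) s) (V t x 4) =
      hsDpDtheta F σ (V t x 0) := fun t ht x =>
    deriv_hsPressure_temperature_eq_hsDpDtheta hF _ (hpack t ht x)
  have hpρ : ∀ t ∈ Ico 0 T, ∀ x, deriv (fun r => hsPressure σ r (V t x 4)) (V t x 0) ≠ 0 := by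
    intro t ht x
    have h := deriv_hsPressure_density_ge hFa hF hc (hθpos t ht x) (hpack t ht x) (hVO t ht x).2.2.le
    have := hθpos t ht x
    exact (lt_of_lt_of_le (by linarith) h).ne'
  -- the dictionary between the components of the derivatives of `V` and those of `ρ, u, θ`
  have e_t0 : ∀ t ∈ Ico 0 T, ∀ x, (timeDerivWithin (Ico 0 T) V t x) 0 =
      timeDerivWithin (Ico 0 T) (fun s y => V s y 0) t x := fun t ht x =>
    (timeDerivWithin_clm_apply (EuclideanSpace.proj (0 : Fin 5)) hV hS ht x).symm
  have e_t4 : ∀ t ∈ Ico 0 T, ∀ x, (timeDerivWithin (Ico 0 T) V t x) 4 =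
      timeDerivWithin (Ico 0 T) (fun s y => V s y 4) t x := fun t ht x =>
    (timeDerivWithin_clm_apply (EuclideanSpace.proj (4 : Fin 5)) hV hS ht x).symm
  have e_tu : ∀ t ∈ Ico 0 T, ∀ x, ∀ j, (timeDerivWithin (Ico 0 T) V t x) (hsVelIdx j) =
      timeDerivWithin (Ico 0 T) (fun s y => hsVelPart (V s y)) t x j := fun t ht x j => by
    rw [timeDerivWithin_clm_apply hsVelPart hV hS ht x, hsVelPart_apply]
  have e_x0 : ∀ t ∈ Ico 0 T, ∀ x, ∀ k, (partialDeriv k (V t) x) 0 =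
      partialDeriv k (fun y => V t y 0) x := fun t ht x k =>
    (partialDeriv_clm_apply_of_isContDiff (EuclideanSpace.proj (0 : Fin 5)) (hV1 ht) k x).symm
  have e_x4 : ∀ t ∈ Ico 0 T, ∀ x, ∀ k, (partialDeriv k (V t) x) 4 =
      partialDeriv k (fun y => V t y 4) x := fun t ht x k =>
    (partialDeriv_clm_apply_of_isContDiff (EuclideanSpace.proj (4 : Fin 5)) (hV1 ht) k x).symm
  have e_xu : ∀ t ∈ Ico 0 T, ∀ x, ∀ k j, (partialDeriv k (V t) x) (hsVelIdx j) =
      partialDeriv k (fun y => hsVelPart (V t y)) x j := fun t ht x k j => by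
    rw [partialDeriv_clm_apply_of_isContDiff hsVelPart (hV1 ht) k x, hsVelPart_apply]
  have hu1 : ∀ {t}, t ∈ Ico 0 T → IsContDiff 1 (fun y => hsVelPart (V t y)) := fun ht =>
    (hu.isSmooth_slice ht).isContDiff (by simp)
  have e_div : ∀ t ∈ Ico 0 T, ∀ x, ∑ k, (partialDeriv k (V t) x) (hsVelIdx k) =
      divergence (fun y => hsVelPart (V t y)) x := fun t ht x => by
    unfold divergence
    refine Finset.sum_congr rfl fun k _ => ?_
    rw [e_xu t ht x k k, partialDeriv_apply_coord (hu1 ht) k x k]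
  refine IsHardSphereEulerSolution.of_symmetricForm hFa hF hρ hu hθ hρpos hθpos hpack hpρ ?_ ?_ ?_
  · intro t ht x
    have h := congr_fun (hEq t ht x) 0
    rw [hsSym_row_zero] at h
    simp only [Pi.zero_apply] at h
    rw [hdρ t ht x]
    simpa only [e_t0 t ht x, e_x0 t ht x, e_div t ht x, hsVelPart_apply] using h
  · intro t ht x j
    have h := congr_fun (hEq t ht x) (hsVelIdx j)
    rw [hsSym_row_vel] at h
    simp only [Pi.zero_apply] at h
    rw [hdρ t ht x, hdθ t ht x]
    simpa only [e_tu t ht x, e_xu t ht x, e_x0 t ht x, e_x4 t ht x, hsVelPart_apply] using h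
  · intro t ht x
    have h := congr_fun (hEq t ht x) 4
    rw [hsSym_row_four] at h
    simp only [Pi.zero_apply] at h
    rw [hdθ t ht x]
    simpa only [e_t4 t ht x, e_x4 t ht x, e_div t ht x, hsVelPart_apply] using h


/-! ### Step 5e: `hsEuler_localExistence` from the local existence theorem for smooth symmetric
hyperbolic systems on `𝕋³` (Steps 1–4) -/

/-- The packed state vector `V₀ = (ρ₀, u₀, θ₀) : 𝕋³ → ℝ⁵` of primitive data. [folklore] -/
def hsStateVec (ρ₀ : T3 → ℝ) (u₀ : T3 → V3) (θ₀ : T3 → ℝ) (x : T3) : E5 :=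
  WithLp.toLp 2 ![ρ₀ x, u₀ x 0, u₀ x 1, u₀ x 2, θ₀ x]

/-- The density slot of the packed state vector. [folklore] -/
@[simp] theorem hsStateVec_apply_zero (ρ₀ : T3 → ℝ) (u₀ : T3 → V3) (θ₀ : T3 → ℝ) (x : T3) :
    hsStateVec ρ₀ u₀ θ₀ x 0 = ρ₀ x := rfl

/-- The temperature slot of the packed state vector. [folklore] -/
@[simp] theorem hsStateVec_apply_four (ρ₀ : T3 → ℝ) (u₀ : T3 → V3) (θ₀ : T3 → ℝ) (x : T3) :
    hsStateVec ρ₀ u₀ θ₀ x 4 = θ₀ x := rfl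

/-- The velocity slots of the packed state vector. [folklore] -/
@[simp] theorem hsStateVec_apply_hsVelIdx (ρ₀ : T3 → ℝ) (u₀ : T3 → V3) (θ₀ : T3 → ℝ) (x : T3)
    (k : Fin 3) : hsStateVec ρ₀ u₀ θ₀ x (hsVelIdx k) = u₀ x k := by
  fin_cases k <;> rfl

/-- The velocity part of the packed state vector is the velocity. [folklore] -/
@[simp] theorem hsVelPart_hsStateVec (ρ₀ : T3 → ℝ) (u₀ : T3 → V3) (θ₀ : T3 → ℝ) (x : T3) :
    hsVelPart (hsStateVec ρ₀ u₀ θ₀ x) = u₀ x := by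
  ext k
  rw [hsVelPart_apply, hsStateVec_apply_hsVelIdx]

/-- Smooth primitive data give a smooth state vector. [folklore] -/
theorem isSmooth_hsStateVec {ρ₀ θ₀ : T3 → ℝ} {u₀ : T3 → V3} (hρ₀ : IsSmooth ρ₀) (hθ₀ : IsSmooth θ₀)
    (hu₀ : IsSmooth u₀) : IsSmooth (hsStateVec ρ₀ u₀ θ₀) := by
  unfold IsSmooth
  rw [contDiff_euclidean]
  intro i
  fin_cases i
  · exact hρ₀
  · exact hu₀.apply 0
  · exact hu₀.apply 1
  · exact hu₀.apply 2
  · exact hθ₀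

/-- **The assembly of `hsEuler_localExistence` from the local existence theorem for smooth
symmetric hyperbolic quasilinear systems on `𝕋³` (Steps 1–4 of the printed proof).** The
hypothesis `H` — NOT asserted here, and NOT to be vendored as a named fact (Majda's theorem is
vendored once, as `Literature.Analysis.FluidPDE.CompressibleEulerLocalWellPosedness`, to which
`hsEuler_localExistence_of_compressibleEulerLocalWellPosedness` of
`HardSphereEulerLocalTheoryReduction.lean` already reduces the fact; the debt is
`CompressibleEulerLocalWellPosedness_holds`) — is the classical theorem in the `C^∞` form: for every `N`, every open `𝒪 ⊆ ℝᴺ`, all coefficient matrices `A⁰, A₁, A₂, A₃`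
smooth on `𝒪` with `A⁰` symmetric positive definite and the `Aₖ` symmetric on `𝒪`, and all
smooth data `V₀ : 𝕋³ → ℝᴺ` with values in a compact subset of `𝒪`, there are `T > 0` and a jointly
smooth `V` on `[0, T) × 𝕋³` with values in `𝒪`, `V(0) = V₀`, solving
`A⁰(V)∂ₜV + ∑ₖ Aₖ(V)∂ₖV = 0` pointwise (one-sided time derivative within `[0, T)`): Majda 1984,
Ch. 2, Thm 2.1 (local `Hˢ` solution with values in `G₂ ⊂⊂ G`, for data in `G₁ ⊂⊂ G`) with
Cor. 1–2 of Thm 2.2 (`s`-independent life span, so `H^∞ = C^∞` data give `C^∞` solutions); on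
the torus Taylor, *PDE III*, Ch. 16, §§1–2; Dafermos 2005, Thm 5.1.1 (Steps 1–4 of its proof).
Given `H` (e.g. once it is PROVED in the tree, which also discharges clause (i) of
`CompressibleEulerLocalWellPosedness` by the same assembly), the fact follows from Step 0
(`HardSphereEulerLocalTheoryProofs.lean`) and Step 5: `η₁ = η_c/2` with `η_c(η₀, F)` the
packing threshold; for `σ > 0` the hard-sphere system in `V = (ρ, u, θ)` with the coefficients
`hsSymA0`, `hsSymA` on the state domain `𝒪 = {ρ > 0, θ > 0, ρσ³ < η_c}` satisfies the
hypotheses of `H` (`contDiffOn_hsSymA0_hsSymA`, `posDef_hsSymA0`, `isSymm_hsSymA`); the data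
`(ρ₀, u₀, θ₀)` with `ρ₀σ³ ≤ η₁` have compact range inside `𝒪`; and the solution `V` of `H` is a
classical hard-sphere Euler solution by `IsHardSphereEulerSolution.of_symmVector`.
[cite: Dafermos2005, Thm 5.1.1] -/
theorem hsEuler_localExistence_of_symmHyperbolicLocalExistence
    (H : ∀ (N : ℕ) (O : Set (EuclideanSpace ℝ (Fin N)))
      (A₀ : EuclideanSpace ℝ (Fin N) → Matrix (Fin N) (Fin N) ℝ)
      (A : Fin 3 → EuclideanSpace ℝ (Fin N) → Matrix (Fin N) (Fin N) ℝ),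
      IsOpen O →
      (∀ i j, ContDiffOn ℝ ∞ (fun v => A₀ v i j) O) →
      (∀ k i j, ContDiffOn ℝ ∞ (fun v => A k v i j) O) →
      (∀ v ∈ O, (A₀ v).PosDef) → (∀ k, ∀ v ∈ O, (A k v).IsSymm) →
      ∀ V₀ : T3 → EuclideanSpace ℝ (Fin N), IsSmooth V₀ →
        (∃ K, IsCompact K ∧ K ⊆ O ∧ ∀ x, V₀ x ∈ K) →
        ∃ T : ℝ, 0 < T ∧ ∃ V : ℝ → T3 → EuclideanSpace ℝ (Fin N),
          IsSmoothSpaceTimeOn (Ico 0 T) V ∧ V 0 = V₀ ∧ (∀ t ∈ Ico 0 T, ∀ x, V t x ∈ O) ∧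
          ∀ t ∈ Ico 0 T, ∀ x,
            (A₀ (V t x)).mulVec (WithLp.ofLp (timeDerivWithin (Ico 0 T) V t x)) +
              ∑ k, (A k (V t x)).mulVec (WithLp.ofLp (partialDeriv k (V t) x)) = 0) :
    hsEuler_localExistence := by
  intro η₀ hη₀ F hFa hF
  obtain ⟨η_c, hc0, hcη₀, hc⟩ := exists_packing_threshold hη₀ hFa
  refine ⟨η_c / 2, by positivity, fun σ hσ ρ₀ θ₀ u₀ hρ₀ hθ₀ hu₀ hρ₀pos hθ₀pos hpack₀ => ?_⟩
  -- hypotheses of `H` for the hard-sphere system on `𝒪 = {ρ > 0, θ > 0, ρσ³ < η_c}`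
  obtain ⟨hA0s, hAs⟩ := contDiffOn_hsSymA0_hsSymA (F := F) hFa hσ.le hcη₀.le (σ := σ)
  have hPD : ∀ v ∈ hsStateDomain σ η_c, (hsSymA0 F σ v).PosDef := by
    intro v hv
    have hvpack : v 0 * σ ^ 3 ∈ Ioo 0 η₀ := ⟨mul_pos hv.1 (pow_pos hσ 3), hv.2.2.trans hcη₀⟩
    have hge := deriv_hsPressure_density_ge hFa hF hc hv.2.1 hvpack hv.2.2.le
    rw [deriv_hsPressure_density_eq_hsDpDrho hFa hF _ hvpack] at hge
    have hθ := hv.2.1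
    exact posDef_hsSymA0 F σ hv.1 hv.2.1 (lt_of_lt_of_le (by linarith) hge)
  have hSy : ∀ k, ∀ v ∈ hsStateDomain σ η_c, (hsSymA F σ k v).IsSymm := fun k v _ =>
    isSymm_hsSymA F σ k v
  -- the data
  have hV₀ : IsSmooth (hsStateVec ρ₀ u₀ θ₀) := isSmooth_hsStateVec hρ₀ hθ₀ hu₀
  have hK : ∃ K, IsCompact K ∧ K ⊆ hsStateDomain σ η_c ∧ ∀ x, hsStateVec ρ₀ u₀ θ₀ x ∈ K := by
    refine ⟨range (hsStateVec ρ₀ u₀ θ₀), isCompact_range hV₀.continuous, ?_, fun x => ⟨x, rfl⟩⟩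
    rintro _ ⟨x, rfl⟩
    refine ⟨?_, ?_, ?_⟩
    · simpa using hρ₀pos x
    · simpa using hθ₀pos x
    · have h := hpack₀ x
      simp only [hsStateVec_apply_zero]
      linarith
  obtain ⟨T, hT, V, hV, hV0, hVO, hEq⟩ := H 5 (hsStateDomain σ η_c) (hsSymA0 F σ) (hsSymA F σ)
    (isOpen_hsStateDomain σ η_c) hA0s hAs hPD hSy (hsStateVec ρ₀ u₀ θ₀) hV₀ hK
  refine ⟨T, hT, fun t x => V t x 0, fun t x => V t x 4, fun t x => hsVelPart (V t x),
    IsHardSphereEulerSolution.of_symmVector hFa hF hcη₀ hc hσ hV hVO hEq, ?_, ?_, ?_⟩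
  · funext x
    simp [hV0]
  · funext x
    simp [hV0]
  · funext x
    simp [hV0]

end SymmetricForm

end Literature.MathematicalPhysics.KineticTheory

end
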